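import Literature.Geometry.Kaehler.ComplexTorusEndomorphismSubfieldMultiplicitiesCenter
import Literature.Geometry.Kaehler.ComplexTorusHodgeLieAlgebraFiniteCenter
import HarnessLib

/-!
# `Hg(X)` semisimple ⟹ every subfield `F ⊆ End⁰(X)` is of Weil type: `n_σ = n_{σ'} = dim X/[F:ℚ]` for all `σ`
# (Moonen–Zarhin, *Weil classes on abelian varieties*, J. reine angew. Math. 496 (1998), (6) Remark with (4) Criterion —
# "the Hodge group `Hdg(X)` is semi-simple, hence contained in `Sl_F(V_X)`" — at torus level, infinitesimally)

Layer `Literature/Geometry/Kaehler`, namespace `Literature.Geometry.Kaehler.ComplexTorus`; lane `lit-hodgefound`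
(Track 2 foundations library), seat p11, generation 17, row g17-#5.  THEOREMS ONLY (no definition, no named fact;
D-0026, net debt 0).  Sequel, BY NAME (nothing restated), of
`ComplexTorusEndomorphismSubfieldMultiplicitiesCenter.lean` (g17-#3: `J = Z + D` in `𝔥𝔤_ℝ = 𝔷 ⊕ [𝔥𝔤_ℝ, 𝔥𝔤_ℝ]`,
`tr(J ⊗ 1 | V_{ℂ,σ}) = i(2 n_σ - d)`, `tr([X, Y] ∘ p) = 0`), `ComplexTorusHodgeLieAlgebraNoTypeFourSemisimple.lean` /
`ComplexTorusHodgeLieAlgebraFiniteCenter.lean` (p-seats g16: `𝔷(𝔥𝔤_ℝ) = 0` from "no factor of type IV", from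
`Z(𝔤) = 0`, from a finite centre of `Hg(X)(ℂ)`), `ComplexTorusEndomorphismFieldEigenspaces.lean` (p13: `n_σ`,
`n_σ + n_{σ'} = d`, `dim V_{ℂ,σ} · [F:ℚ] = 2 dim X`) and `ComplexTorusMaximalCMSubfieldCenter.lean` (g16-#2, whose
`finrank_iInf_eigenspace_analyticRepHom_conjugate_eq_of_center_real` printed this use of [MZ] for `K` CM, MAXIMAL
commutative, centre real — here for ANY subfield, from semisimplicity alone, by the printed mechanism `Hdg ⊆ SL_F`).

## Source, verbatim

B. J. J. Moonen, Yu. G. Zarhin, *Weil classes on abelian varieties*, J. reine angew. Math. 496 (1998) 83–92 (held text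
`paper:arxiv-alg-geom_9612017`, p0001; paragraphs numbered consecutively):

* (3): «Write `Σ_F` for the set of embeddings `F → ℂ`, and for `σ ∈ Σ_F`, let `σ'` denote its complex conjugate. The
  action of `F` on `V_X` gives a decomposition of `V_ℂ = V_X ⊗_ℚ ℂ` as `V_ℂ = ⊕_{σ ∈ Σ_F} V_{ℂ,σ} =
  ⊕_{σ ∈ Σ_F} (V_{ℂ,σ}^{1,0} ⊕ V_{ℂ,σ}^{0,1})`. The dimension `n_σ` of `V_{ℂ,σ}^{1,0}` is called the multiplicity of
  `σ` on the tangent space of `X`; we have `n_σ + n_{σ'} = 2g/[F:ℚ]` for all `σ ∈ Σ_F`. […] `W_F ⊗ ℂ = (⋀^r_F V_X) ⊗ ℂ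
  = […] = ⊕_{σ ∈ Σ_F} (⋀^{n_σ}_ℂ V_{ℂ,σ}^{1,0} ⊗ ⋀^{n_{σ'}} V_{ℂ,σ}^{0,1})`.»
* (4): «Criterion. If `n_σ = n_{σ'}` for all `σ ∈ Σ_F` then `W_F` consists entirely of Hodge classes; if
  `n_σ ≠ n_{σ'}` for some `σ ∈ Σ_F` then the zero class is the only Hodge class in `W_F`.»
* (6): «Remark. If all simple factors of `X` are of type 1, 2 or 3 in the Albert classification, then every subfield
  `F ⊆ End⁰(X)` satisfies the condition that `n_σ = n_{σ'}` for all `σ ∈ Σ_F`. We can see this as follows: we have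
  an inclusion `Hdg(X) ⊂ Gl_F(V_X)` and `Hdg(X)` acts on `W_F` through the `F`-linear determinant
  `det_F : Gl_F(V_X) → Res_{F/ℚ}(𝔾_{m,F})`. If `X` has no factors of type 4 then the Hodge group `Hdg(X)` is
  semi-simple (see [Chi]), hence contained in `Sl_F(V_X)`, which means that `W_F` consists of Hodge classes.»

Used the same way in Yu. G. Zarhin, *Cyclic covers of the projective line, their jacobians and endomorphisms*, J.
reine angew. Math. 544 (2002), proof of Thm. 3.8 (i) (held `paper:arxiv-math_0008134`, p0008): «Since the center `𝒞`
of `End⁰(J^{f,p})` is totally real, the Hodge group of `J^{(f,p)}` must be semisimple. This implies that the pair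
`(J^{(f,p)}, ℚ(δ_p))` is of Weil type ([MZ]), i.e., `ℚ(δ_p)` acts on `Ω¹(J^{(f,p)})` in such a way that for each
embedding `σ : ℚ(δ_p) ↪ ℂ` the corresponding multiplicity `n_σ = dim(J^{(f,p)})/[ℚ(δ_p):ℚ]`.»

## Statement formalised (torus level) and the infinitesimal proof

`(X = E/Φ(ℤ^ι), η)` a polarised complex torus (`|ι| = 2 dim X`), `f : K →ₐ[ℚ] M_ι(ℚ)` ANY number field inside
`End⁰(X) = endAlgRat Φ` (no hypothesis relating `f(K)` to the centre of `End⁰(X)`), `n_σ` p13's multiplicity of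
`σ : K →+* ℂ` on `T₀X`, `V_{ℂ,σ} ⊆ V_ℂ = ℂ^ι` the simultaneous eigenspace of `f(K) ⊗ 1`, `d = dim V_{ℂ,σ} =
2 dim X/[K:ℚ]`.  "`Hdg(X)` semi-simple" is taken at the Lie algebra, `𝔷(𝔥𝔤_ℝ) = 0`
(`hss : ∀ Z ∈ hodgeGroupLie Φ, (∀ Y ∈ hodgeGroupLie Φ, Z Y = Y Z) → Z = 0`), and in the tree's equivalent / sufficient
forms (§3).  The printed mechanism "`Hdg(X) ⊂ Gl_F(V_X)` […] semi-simple, hence contained in `Sl_F(V_X)`" becomes: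
`𝔥𝔤_ℝ ⊗ 1` preserves each `V_{ℂ,σ}` (it commutes with `F`), the `σ`-component `X ↦ tr(X ⊗ 1 | V_{ℂ,σ})` of the
`F ⊗ ℂ`-trace (the differential of `det_F`) kills `[𝔥𝔤_ℝ, 𝔥𝔤_ℝ]` (§1), and `𝔥𝔤_ℝ = [𝔥𝔤_ℝ, 𝔥𝔤_ℝ]` when
`𝔷(𝔥𝔤_ℝ) = 0` (g17-#3's `J = Z + D`, `Z` central); applied to `J ∈ 𝔥𝔤_ℝ`, whose trace on `V_{ℂ,σ}` is `i(2 n_σ - d)`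
(g17-#3), this gives `2 n_σ = d`, i.e. `n_σ = n_{σ'}` — the conclusion the Criterion (4) draws for `W_F`:

* §1 `trace_toLin'_map_mul_eq_zero_of_mem_span_commutator` — `tr((D ⊗ 1) ∘ p_σ) = 0` for `D ∈ [𝔥𝔤_ℝ, 𝔥𝔤_ℝ]` and any
  projector `p_σ` onto `V_{ℂ,σ}`.
* §2 **`IsRiemannForm.two_mul_finrank_iInf_eigenspace_analyticRepHom_mul_finrank_of_forall_central_eq_zero`** —
  `𝔷(𝔥𝔤_ℝ) = 0 ⟹ 2 n_σ [K:ℚ] = 2 dim X` for every `f`, `σ`; **`…conjugate_eq_of_forall_central_eq_zero`** — hence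
  `n_{σ'} = n_σ` (with p13's `n_σ + n_{σ'} = d`).
* §3 the same conclusion from `LieAlgebra.center ℂ (hodgeGroupComplexLie Φ) = ⊥`
  (`…_of_center_hodgeGroupComplexLie_eq_bot`), from `LieAlgebra.IsSemisimple ℂ (hodgeGroupComplexLie Φ)`
  (`…_of_isSemisimple`), from "no factor of type IV" = the Rosati involution fixes the centre of `End⁰(X)`
  (`…_of_forall_rosati_eq`, the Remark (6) as printed), and from a finite centre of `Hg(X)(ℂ)` (`…_of_finite_center`).

NOT HERE: the spaces of Weil classes `W_F = ⋀^r_F V_X ⊆ H^r(X, ℚ)` and the Criterion (4) itself (exterior powers over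
`F` inside `H^•(X, ℚ)`); Albert types; [Chi]'s theorem beyond the tree's Lie-algebra forms.

## References

* [MoonenZarhin1998WeilClasses] B. J. J. Moonen, Yu. G. Zarhin, Weil classes on abelian varieties, J. reine angew.
  Math. 496 (1998) 83–92, (3), (4) Criterion, (6) Remark (arXiv alg-geom/9612017, p0001).
* [Zarhin2002CyclicCovers] Yu. G. Zarhin, Cyclic covers of the projective line, their jacobians and endomorphisms,
  J. reine angew. Math. 544 (2002), §3 Thm. 3.8 (i), proof (arXiv math/0008134, p0008).
* [Zarhin2004EndomorphismRingsCyclicCovers] Yu. G. Zarhin, Math. Proc. Cambridge Philos. Soc. 136 (2004), §2 proof of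
  Thm. 2.3 ("`Tr_E(mt^{ss}) = {0}`").
* [Lange2023AbelianVarietiesComplex] H. Lange, Abelian Varieties over the Complex Numbers (2023), §7.2.4 Exercise (2).
-/

noncomputable section

open Module NumberField Matrix

namespace Literature.Geometry.Kaehler

namespace ComplexTorus

variable {ι : Type*} [Fintype ι] [DecidableEq ι] {E : Type*} [NormedAddCommGroup E] [NormedSpace ℂ E]
  {Φ : (ι → ℝ) ≃L[ℝ] E}

/-! ## §0 Plumbing (private; as in `ComplexTorusEndomorphismSubfieldMultiplicitiesCenter`, where they are private) -/

section Plumbing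

variable {L : Type*} [Field L] {V : Type*} [AddCommGroup V] [Module L V] [FiniteDimensional L V]

/-- `tr(T ∘ p) = tr(T|_W)` for a projector `p` onto a `T`-stable subspace `W`. [folklore] -/
private theorem trace_mul_eq_trace_restrict_of_isProj₅ {W : Submodule L V} {p : V →ₗ[L] V}
    (hp : LinearMap.IsProj W p) {T : V →ₗ[L] V} (hT : ∀ v ∈ W, T v ∈ W) :
    LinearMap.trace L V (T * p) = LinearMap.trace L W (T.restrict hT) := by
  have h1 : ∀ v, (T * p) v ∈ W := fun v ↦ hT _ (hp.map_mem v)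
  rw [← LinearMap.trace_restrict_eq_of_forall_mem W (T * p) h1]
  congr 1
  ext ⟨w, hw⟩
  rw [LinearMap.coe_restrict_apply, LinearMap.coe_restrict_apply, Module.End.mul_apply, hp.map_id w hw]

omit [FiniteDimensional L V] in
/-- Every subspace is the image of a projector. [folklore] -/
private theorem exists_isProj₅ (W : Submodule L V) : ∃ p : V →ₗ[L] V, LinearMap.IsProj W p := by
  obtain ⟨Q, hQ⟩ := W.exists_isCompl
  exact ⟨W.projection Q hQ, ⟨Submodule.projection_apply_mem hQ, fun x hx ↦ Submodule.projection_apply_of_mem_left hQ hx⟩⟩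

end Plumbing

/-- The `ℝ`-linear functional `X ↦ tr((X ⊗ 1) ∘ p)` on real matrices, for a fixed `p ∈ End(V_ℂ)`. [folklore] -/
private theorem exists_linearMap_eq_trace_toLin'_mul₅ (p : Module.End ℂ (ι → ℂ)) :
    ∃ Λ : Matrix ι ι ℝ →ₗ[ℝ] ℂ,
      ∀ X, Λ X = LinearMap.trace ℂ (ι → ℂ) (Matrix.toLin' (X.map Complex.ofRealHom) * p) := by
  refine ⟨{ toFun := fun X ↦ LinearMap.trace ℂ (ι → ℂ) (Matrix.toLin' (X.map Complex.ofRealHom) * p)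
            map_add' := fun X Y ↦ ?_
            map_smul' := fun r X ↦ ?_ }, fun X ↦ rfl⟩
  · rw [Matrix.map_add _ Complex.ofRealHom.map_add, map_add, add_mul, map_add]
  · simp only [RingHom.id_apply]
    have h : (r • X).map Complex.ofRealHom = (r : ℂ) • X.map Complex.ofRealHom := by
      ext i j
      simp [Matrix.map_apply]
    rw [h, map_smul, smul_mul_assoc, map_smul, smul_eq_mul, Complex.real_smul]

section WeilType

variable {K : Type*} [Field K] [NumberField K] (f : K →ₐ[ℚ] Matrix ι ι ℚ) (hf : ∀ x, f x ∈ endAlgRat Φ)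

/-! ## §1 `[𝔥𝔤_ℝ, 𝔥𝔤_ℝ] ⊆ 𝔰𝔩_E(V)`: the derived algebra has vanishing `E_ℂ`-trace -/

include hf in
/-- **`Hdg(X) ⊆ GL_F(V_X)` acts on `W_F = ⋀^r_F V_X` through `det_F`, trivially on `[Hdg, Hdg]`** — infinitesimally and
componentwise: for every `σ : F → ℂ`, the `σ`-component `tr((D ⊗ 1) ∘ p_σ) = tr(D ⊗ 1 | V_{ℂ,σ})` of the `F ⊗ ℂ`-trace
vanishes on the derived algebra `D ∈ [𝔥𝔤_ℝ, 𝔥𝔤_ℝ]` (`p_σ` any projector onto the eigenspace `V_{ℂ,σ}`, which `𝔥𝔤_ℝ ⊗ 1`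
preserves since it commutes with `F`). [cite: MoonenZarhin1998WeilClasses, (6) Remark (arXiv p0001: "`Hdg(X) ⊂ Gl_F(V_X)` and `Hdg(X)` acts on `W_F` through the `F`-linear determinant")]
[cite: Zarhin2004EndomorphismRingsCyclicCovers, §2 proof of Thm. 2.3 ("`Tr_E(mt^{ss}) = {0}`")] -/
theorem trace_toLin'_map_mul_eq_zero_of_mem_span_commutator (σ : K →+* ℂ) {p : Module.End ℂ (ι → ℂ)}
    (hp : LinearMap.IsProj (⨅ y : K, Module.End.eigenspace (Matrix.toLin' ((f y).map (algebraMap ℚ ℂ))) (σ y)) p)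
    {D : Matrix ι ι ℝ}
    (hD : D ∈ Submodule.span ℝ {B : Matrix ι ι ℝ | ∃ X ∈ hodgeGroupLie Φ, ∃ Y ∈ hodgeGroupLie Φ, X * Y - Y * X = B}) :
    LinearMap.trace ℂ (ι → ℂ) (Matrix.toLin' (D.map Complex.ofRealHom) * p) = 0 := by
  obtain ⟨Λ, hΛ⟩ := exists_linearMap_eq_trace_toLin'_mul₅ (ι := ι) p
  have hstab : ∀ X ∈ hodgeGroupLie Φ,
      ∀ v ∈ (⨅ y : K, Module.End.eigenspace (Matrix.toLin' ((f y).map (algebraMap ℚ ℂ))) (σ y)),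
        Matrix.toLin' (X.map Complex.ofRealHom) v ∈
          (⨅ y : K, Module.End.eigenspace (Matrix.toLin' ((f y).map (algebraMap ℚ ℂ))) (σ y)) := fun X hX ↦
    toLin'_map_mem_iInf_eigenspace_of_comm f (fun y ↦ map_ratCast_comm_of_mem_endAlgRat (hf y) hX) σ
  have hle : Submodule.span ℝ
      {B : Matrix ι ι ℝ | ∃ X ∈ hodgeGroupLie Φ, ∃ Y ∈ hodgeGroupLie Φ, X * Y - Y * X = B} ≤ LinearMap.ker Λ := by
    refine Submodule.span_le.2 ?_
    rintro _ ⟨X, hX, Y, hY, rfl⟩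
    rw [SetLike.mem_coe, LinearMap.mem_ker, hΛ, Matrix.map_sub _ Complex.ofRealHom.map_sub, Matrix.map_mul,
      Matrix.map_mul, map_sub, Matrix.toLin'_mul, Matrix.toLin'_mul]
    exact trace_commutator_mul_eq_zero_of_isProj hp (hstab X hX) (hstab Y hY)
  rw [← hΛ]
  exact LinearMap.mem_ker.1 (hle hD)

/-! ## §2 `Hg(X)` semisimple ⟹ every subfield `F ⊆ End⁰(X)` is of Weil type: `n_σ = n_σ' = d/2` -/

include hf in
/-- **`𝔷(𝔥𝔤_ℝ) = 0 ⟹ 2 n_σ [F:ℚ] = 2 dim X` for EVERY number field `F ⊆ End⁰(X)` and every `σ`** (polarised complex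
torus) — Moonen–Zarhin: "the Hodge group `Hdg(X)` is semi-simple […], hence contained in `Sl_F(V_X)`", which by their
Criterion means `n_σ = n_{σ'}` for all `σ ∈ Σ_F`.  At the Lie algebra: `J = Z + D` with `Z` central (so `Z = 0`) and
`D ∈ [𝔥𝔤_ℝ, 𝔥𝔤_ℝ]` (`IsRiemannForm.exists_central_add_mem_span_commutator_eq_jMatrix`), so
`i(2 n_σ - d) = tr(J ⊗ 1 | V_{ℂ,σ}) = tr(D ⊗ 1 | V_{ℂ,σ}) = 0` (§1 and `trace_restrict_toLin'_jMatrix_iInf_eigenspace`),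
`d = dim V_{ℂ,σ} = 2 dim X/[F:ℚ]`.  No hypothesis on the centre of `End⁰(X)` relative to `F` is needed.
[cite: MoonenZarhin1998WeilClasses, (4) Criterion and (6) Remark (arXiv p0001: "If `X` has no factors of type 4 then the Hodge group `Hdg(X)` is semi-simple (see [Chi]), hence contained in `Sl_F(V_X)`")]
[cite: Zarhin2002CyclicCovers, §3 Thm 3.8 (i) (proof, p0008: "the Hodge group of `J^{(f,p)}` must be semisimple. This implies that the pair `(J^{(f,p)}, ℚ(δ_p))` is of Weil type")] -/
theorem IsRiemannForm.two_mul_finrank_iInf_eigenspace_analyticRepHom_mul_finrank_of_forall_central_eq_zero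
    {η : E [⋀^Fin 2]→L[ℝ] ℝ} (hη : IsRiemannForm Φ η)
    (hss : ∀ Z ∈ hodgeGroupLie Φ, (∀ Y ∈ hodgeGroupLie Φ, Z * Y = Y * Z) → Z = 0) (σ : K →+* ℂ) :
    2 * finrank ℂ ↥(⨅ y : K, Module.End.eigenspace
        ((analyticRepHom Φ ⟨f y, hf y⟩ : E →L[ℂ] E) : E →ₗ[ℂ] E) (σ y)) * finrank ℚ K = Fintype.card ι := by
  classical
  obtain ⟨p, hp⟩ := exists_isProj₅
    (⨅ y : K, Module.End.eigenspace (Matrix.toLin' ((f y).map (algebraMap ℚ ℂ))) (σ y))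
  obtain ⟨Z, hZ, hZc, D, hD, hJ⟩ := hη.exists_central_add_mem_span_commutator_eq_jMatrix
  rw [hss Z hZ hZc, zero_add] at hJ
  have hJstab : ∀ v ∈ (⨅ y : K, Module.End.eigenspace (Matrix.toLin' ((f y).map (algebraMap ℚ ℂ))) (σ y)),
      Matrix.toLin' ((jMatrix Φ).map Complex.ofRealHom) v ∈
        (⨅ y : K, Module.End.eigenspace (Matrix.toLin' ((f y).map (algebraMap ℚ ℂ))) (σ y)) :=
    toLin'_map_mem_iInf_eigenspace_of_comm f
      (fun y ↦ map_ratCast_comm_of_mem_endAlgRat (hf y) jMatrix_mem_hodgeGroupLie) σ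
  have h0 : LinearMap.trace ℂ (ι → ℂ) (Matrix.toLin' ((jMatrix Φ).map Complex.ofRealHom) * p) = 0 := by
    rw [hJ]
    exact trace_toLin'_map_mul_eq_zero_of_mem_span_commutator f hf σ hp hD
  rw [trace_mul_eq_trace_restrict_of_isProj₅ hp hJstab,
    trace_restrict_toLin'_jMatrix_iInf_eigenspace Φ f hf σ hJstab, mul_eq_zero, sub_eq_zero] at h0
  have h2 : 2 * finrank ℂ ↥(⨅ y : K, Module.End.eigenspace
      ((analyticRepHom Φ ⟨f y, hf y⟩ : E →L[ℂ] E) : E →ₗ[ℂ] E) (σ y)) =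
      finrank ℂ ↥(⨅ y : K, Module.End.eigenspace (Matrix.toLin' ((f y).map (algebraMap ℚ ℂ))) (σ y)) := by
    exact_mod_cast h0.resolve_left Complex.I_ne_zero
  rw [h2]
  exact finrank_iInf_eigenspace_toLin'_map_mul_finrank f σ

include hf in
/-- **… so `n_σ = n_{σ'}`** ("the pair is of Weil type"). [cite: MoonenZarhin1998WeilClasses, (4) Criterion and (6) Remark (arXiv p0001)] -/
theorem IsRiemannForm.finrank_iInf_eigenspace_analyticRepHom_conjugate_eq_of_forall_central_eq_zero
    [FiniteDimensional ℂ E] {η : E [⋀^Fin 2]→L[ℝ] ℝ} (hη : IsRiemannForm Φ η)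
    (hss : ∀ Z ∈ hodgeGroupLie Φ, (∀ Y ∈ hodgeGroupLie Φ, Z * Y = Y * Z) → Z = 0) (σ : K →+* ℂ) :
    finrank ℂ ↥(⨅ y : K, Module.End.eigenspace
        ((analyticRepHom Φ ⟨f y, hf y⟩ : E →L[ℂ] E) : E →ₗ[ℂ] E) (NumberField.ComplexEmbedding.conjugate σ y)) =
      finrank ℂ ↥(⨅ y : K, Module.End.eigenspace
        ((analyticRepHom Φ ⟨f y, hf y⟩ : E →L[ℂ] E) : E →ₗ[ℂ] E) (σ y)) := by
  have h1 := hη.two_mul_finrank_iInf_eigenspace_analyticRepHom_mul_finrank_of_forall_central_eq_zero f hf hss σ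
  have h2 := finrank_iInf_eigenspace_analyticRepHom_add_conjugate_mul_finrank Φ f hf σ
  have hK : 0 < finrank ℚ K := Module.finrank_pos
  have h3 := Nat.eq_of_mul_eq_mul_right hK (h2.trans h1.symm)
  omega

/-! ## §3 The printed hypotheses: `Z(𝔤) = 0`, `𝔤` semisimple, no factor of type IV, `Z(Hg(X)(ℂ))` finite -/

include hf in
/-- `Z(Lie Hg(X)(ℂ)) = 0 ⟹ 2 n_σ [F:ℚ] = 2 dim X` (via `center_hodgeGroupComplexLie_eq_bot_iff`).
[cite: MoonenZarhin1998WeilClasses, (6) Remark (arXiv p0001)] [cite: Lange2023AbelianVarietiesComplex, §7.2.4 Exercise (2)] -/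
theorem IsRiemannForm.two_mul_finrank_iInf_eigenspace_analyticRepHom_mul_finrank_of_center_hodgeGroupComplexLie_eq_bot
    {η : E [⋀^Fin 2]→L[ℝ] ℝ} (hη : IsRiemannForm Φ η)
    (hZ : LieAlgebra.center ℂ (hodgeGroupComplexLie Φ) = ⊥) (σ : K →+* ℂ) :
    2 * finrank ℂ ↥(⨅ y : K, Module.End.eigenspace
        ((analyticRepHom Φ ⟨f y, hf y⟩ : E →L[ℂ] E) : E →ₗ[ℂ] E) (σ y)) * finrank ℚ K = Fintype.card ι :=
  hη.two_mul_finrank_iInf_eigenspace_analyticRepHom_mul_finrank_of_forall_central_eq_zero f hf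
    ((center_hodgeGroupComplexLie_eq_bot_iff Φ).1 hZ) σ

include hf in
/-- **"the Hodge group `Hdg(X)` is semi-simple, hence contained in `Sl_F(V_X)`": `Lie Hg(X)(ℂ)` SEMISIMPLE ⟹
`2 n_σ [F:ℚ] = 2 dim X` for every subfield `F ⊆ End⁰(X)` and every `σ`.**
[cite: MoonenZarhin1998WeilClasses, (6) Remark (arXiv p0001)] [cite: Zarhin2002CyclicCovers, §3 Thm 3.8 (i) (proof, p0008)] -/
theorem IsRiemannForm.two_mul_finrank_iInf_eigenspace_analyticRepHom_mul_finrank_of_isSemisimple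
    {η : E [⋀^Fin 2]→L[ℝ] ℝ} (hη : IsRiemannForm Φ η) [LieAlgebra.IsSemisimple ℂ (hodgeGroupComplexLie Φ)]
    (σ : K →+* ℂ) :
    2 * finrank ℂ ↥(⨅ y : K, Module.End.eigenspace
        ((analyticRepHom Φ ⟨f y, hf y⟩ : E →L[ℂ] E) : E →ₗ[ℂ] E) (σ y)) * finrank ℚ K = Fintype.card ι :=
  hη.two_mul_finrank_iInf_eigenspace_analyticRepHom_mul_finrank_of_center_hodgeGroupComplexLie_eq_bot f hf
    (LieAlgebra.center_eq_bot ℂ (hodgeGroupComplexLie Φ)) σ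

include hf in
/-- **MOONEN–ZARHIN (5): "If all simple factors of `X` are of type 1, 2 or 3 in the Albert classification, then every
subfield `F ⊆ End⁰(X)` satisfies the condition that `n_σ = n_{σ'}` for all `σ ∈ Σ_F`"** — at torus level with the
tree's "no type IV" hypothesis (the Rosati involution is trivial on the centre of `End⁰(X)`, as in
`IsRiemannForm.eq_zero_of_forall_hodgeGroupLie_comm_of_forall_rosati_eq`): `2 n_σ [F:ℚ] = 2 dim X`.
[cite: MoonenZarhin1998WeilClasses, (6) Remark (arXiv p0001)] -/
theorem IsRiemannForm.two_mul_finrank_iInf_eigenspace_analyticRepHom_mul_finrank_of_forall_rosati_eq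
    {η : E [⋀^Fin 2]→L[ℝ] ℝ} (hη : IsRiemannForm Φ η) {G₀ : Matrix ι ι ℚ}
    (hG₀ : G₀.map (Rat.cast : ℚ → ℝ) = latticeGram Φ η)
    (htriv : ∀ B ∈ endAlgRat Φ, (∀ C ∈ endAlgRat Φ, B * C = C * B) → rosati G₀ B = B) (σ : K →+* ℂ) :
    2 * finrank ℂ ↥(⨅ y : K, Module.End.eigenspace
        ((analyticRepHom Φ ⟨f y, hf y⟩ : E →L[ℂ] E) : E →ₗ[ℂ] E) (σ y)) * finrank ℚ K = Fintype.card ι :=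
  hη.two_mul_finrank_iInf_eigenspace_analyticRepHom_mul_finrank_of_forall_central_eq_zero f hf
    (fun _ hX hc ↦ hη.eq_zero_of_forall_hodgeGroupLie_comm_of_forall_rosati_eq hG₀ htriv hX hc) σ

include hf in
/-- **Finite centre of `Hg(X)(ℂ)` (`Hg(X)` semisimple as a group) ⟹ `2 n_σ [F:ℚ] = 2 dim X`** for every subfield `F` and
every `σ` (via `eq_zero_of_forall_hodgeGroupLie_comm_of_finite_center`). [cite: MoonenZarhin1998WeilClasses, (6) Remark (arXiv p0001)]
[cite: Zarhin2002CyclicCovers, §3 Thm 3.8 (i) (proof, p0008)] -/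
theorem IsRiemannForm.two_mul_finrank_iInf_eigenspace_analyticRepHom_mul_finrank_of_finite_center
    {η : E [⋀^Fin 2]→L[ℝ] ℝ} (hη : IsRiemannForm Φ η)
    (hfin : ((hodgeGroupC Φ ⊓ Subgroup.centralizer (hodgeGroupC Φ : Set (SpecialLinearGroup ι ℂ)) :
      Subgroup (SpecialLinearGroup ι ℂ)) : Set (SpecialLinearGroup ι ℂ)).Finite) (σ : K →+* ℂ) :
    2 * finrank ℂ ↥(⨅ y : K, Module.End.eigenspace
        ((analyticRepHom Φ ⟨f y, hf y⟩ : E →L[ℂ] E) : E →ₗ[ℂ] E) (σ y)) * finrank ℚ K = Fintype.card ι :=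
  hη.two_mul_finrank_iInf_eigenspace_analyticRepHom_mul_finrank_of_forall_central_eq_zero f hf
    (fun _ hX hc ↦ eq_zero_of_forall_hodgeGroupLie_comm_of_finite_center Φ hfin hX hc) σ

end WeilType

end ComplexTorus

end Literature.Geometry.Kaehler

end
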